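/-
COR-CM (cell pub-hodgecm2, stage 2 of the Hodge ladder) — count-neutral kernel combinatorics (seat prover-pub-hodgecm2-b23-g57-0, binder
prover b23, gen 57; lane SYLOW TRANSFER XVII «the odd central factor — rows», blanket `Census/SylowTransfer*` HOME/INBOX.md l.23357, claim l.26753).
Theorems only (part XVI and gen 49ʼs `Census/IndexTwoCyclic{BlockCount,Dichotomy}` BY NAME); no definition, no certificate, no named fact, no
geometry, no `sorry`; `decide` only on the finite sets `{z ∈ ℤ/8 ∣ k·z = 0}` exactly as in gen 49ʼs rows.  `Interfaces.lean` (C1), every E term, B01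
and `Transposition/*` are untouched.
HONEST FRAMING: `HC_CM` is NOT proved, here or anywhere in the tree; nothing here is a period or a headline.
-/
import Summits.HodgeConjecture.CorCM.Census.SylowTransferOddCentral
import Summits.HodgeConjecture.CorCM.Census.IndexTwoCyclicBlockCount
import Summits.HodgeConjecture.CorCM.Census.IndexTwoCyclicDichotomy

/-!
# Sylow transfer, XVII: the odd central factor — rows `(index-two cyclic 2-group) × C_p`

For gen 49ʼs index-two cyclic datum `D : IndexTwoCyclic.Datum H c n` at `2`-power level `n = 2ᵃ` (`H ≅ ℤ/2n ⋊_r ℤ/2`: dihedral, semidihedral,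
modular, abelian…) and a group `A` of prime order `p ≠ 2`, part XVI gives the block count and the coinvariant fibre of `H × A` from `H`:

* §1 `sum_burnside_twisted`: `Σ_h [c ∉ ⟨h⟩]·2^{4n·p / ord h / 2} = 4^{np} + N·2^{np}`, `N = #{g ∉ ⟨u⟩ ∣ g² = 1}` (the `p`-th power twist of gen 49ʼs count).
* §2 **`β(H × A)·(4n·p) = 4^{np} + N·2^{np} + (p − 1)·(4ⁿ + N·2ⁿ)`** (`card_block_prod_mul`), arithmetic form with `N = #{z ∈ ℤ/2n ∣ (r+1)·z = 0}`.
* §3 **ROWS** (level `4`, `p = 3`; `H` of order `16`): `D₈ × C₃ = (24,7)`: **`β = 350224`, `φ₂ = 350222`** (gen 56ʼs first open mixed twist; `μ ∈ {350222, 350223}`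
  by gen 49 IX); `SD₁₆ × C₃`: `β = 349880`, `φ₂ = 349879`; `M₁₆ × C₃`: `β = 349708`, `φ₂ = 349707` (`φ₂` via part XVIʼs
  `fibreTwo_prod_add_card_block` and gen 49ʼs `β(H) = φ₂(H) + [c ∈ ⟨u^{r+1}⟩ ? 1 : 2]`).
All [folklore] bookkeeping over [Pohlmann1968, Thm 1] in the reading of [Milne1999, Prop. 2.1].

## References
* [Pohlmann1968] H. Pohlmann, Algebraic cycles on abelian varieties of complex multiplication type, Ann. of Math. 88 (1968), Thm 1.
* [Milne1999] J. S. Milne, Lefschetz motives and the Tate conjecture, Compositio Math. 117 (1999), Prop. 2.1, p. 54.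
-/

namespace Summit.HodgeConjecture.CorCM.Census.SylowTransfer

open Finset
open Summit.HodgeConjecture.CorCM.Prior.AllgGroup.RfwfAllgGroup
open Summit.HodgeConjecture.CorCM.Census.BlockParity
open Summit.HodgeConjecture.CorCM.Census.Coinvariant
open Summit.HodgeConjecture.CorCM.Census.TypeStabiliser
open Summit.HodgeConjecture.CorCM.Census.IndexTwo
open Summit.HodgeConjecture.CorCM.Census.IndexTwoCyclic

noncomputable section

variable {H A : Type*} [Group H] [Fintype H] [DecidableEq H] [Group A] [Fintype A] [DecidableEq A]
variable {c : H} {n : ℕ} [NeZero n] (D : IndexTwoCyclic.Datum H c n)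

omit [DecidableEq H] [NeZero n] in
include D in
/-- `|H| = 4n` along the datum. [folklore] -/
theorem card_eq_four_mul_of_datum : Fintype.card H = 4 * n := by
  have h := (Subgroup.zpowers D.u).card_mul_index
  rw [Nat.card_zpowers, D.hord, D.hindex, Nat.card_eq_fintype_card] at h
  omega

/-! ## §1 The twisted Burnside sum of an index-two cyclic `2`-group -/

/-- **`Σ_h [c ∉ ⟨h⟩]·2^{4n·p / ord h / 2} = 4^{np} + #{g ∉ ⟨u⟩ ∣ g² = 1}·2^{np}`** at `2`-power level (only `h = 1` and the coset involutions avoid `c`).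
[folklore] -/
theorem sum_burnside_twisted (hc2 : c * c = 1) (hc1 : c ≠ 1) {a : ℕ} (ha : n = 2 ^ a) (p : ℕ) :
    (∑ h : H, if c ∈ Subgroup.zpowers h then 0 else 2 ^ (Fintype.card H * p / orderOf h / 2)) =
      4 ^ (n * p) + (univ.filter fun g : H => g ∉ Subgroup.zpowers D.u ∧ g * g = 1).card * 2 ^ (n * p) := by
  classical
  have hn : 1 ≤ n := Nat.one_le_iff_ne_zero.mpr (NeZero.ne n)
  rw [card_eq_four_mul_of_datum D]
  have hterm : ∀ g : H, (if c ∈ Subgroup.zpowers g then 0 else 2 ^ (4 * n * p / orderOf g / 2)) =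
      (if g = 1 then 4 ^ (n * p) else 0) + (if g ∉ Subgroup.zpowers D.u ∧ g * g = 1 then 2 ^ (n * p) else 0) := by
    intro g
    by_cases hg1 : g = 1
    · subst hg1
      rw [if_neg (by rw [Subgroup.zpowers_one_eq_bot, Subgroup.mem_bot]; exact hc1), if_pos rfl,
        if_neg (fun h => h.1 (Subgroup.one_mem _)), add_zero, orderOf_one, Nat.div_one,
        show 4 * n * p / 2 = 2 * (n * p) by rw [show 4 * n * p = 2 * (2 * (n * p)) by ring]; exact Nat.mul_div_cancel_left _ (by norm_num),
        pow_mul]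
      norm_num
    rw [if_neg hg1, zero_add]
    by_cases hgu : g ∈ Subgroup.zpowers D.u
    · obtain ⟨i, hi, rfl | rfl⟩ := D.exists_pow_or_pow_mul_w g
      · have hi0 : i ≠ 0 := fun h0 => hg1 (by rw [h0, pow_zero])
        rw [if_pos (c_mem_zpowers_pow D hc2 ha hi0 hi), if_neg (fun h => h.1 hgu)]
      · exact absurd hgu (D.pow_mul_w_notMem i)
    · by_cases hgg : g * g = 1
      · have hord : orderOf g = 2 := orderOf_eq_prime (by rw [pow_two, hgg]) hg1
        rw [if_neg (c_notMem_zpowers_of_involution D hc1 hgu hgg), if_pos ⟨hgu, hgg⟩, hord,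
          show 4 * n * p / 2 / 2 = n * p by
            rw [show 4 * n * p = 2 * (2 * (n * p)) by ring, Nat.mul_div_cancel_left _ (by norm_num : 0 < 2),
              Nat.mul_div_cancel_left _ (by norm_num : 0 < 2)]]
      · rw [if_pos (c_mem_zpowers_of_not_involution D hc2 ha hgu hgg), if_neg (fun h => hgg h.2)]
  rw [Finset.sum_congr rfl (fun g _ => hterm g), Finset.sum_add_distrib, Finset.sum_ite_eq' univ (1 : H), if_pos (mem_univ _),
    ← Finset.sum_filter, Finset.sum_const, smul_eq_mul]

/-! ## §2 The block count of `H × C_p` -/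

/-- **`β(H × A)·(4n·p) = 4^{np} + N·2^{np} + (p − 1)·(4ⁿ + N·2ⁿ)`**, `N = #{g ∉ ⟨u⟩ ∣ g² = 1}`, for `|A| = p` an odd prime and `n = 2ᵃ`. [folklore] -/
theorem card_block_prod_mul (hc2 : c * c = 1) (hc1 : c ≠ 1) {a : ℕ} (ha : n = 2 ^ a) {p : ℕ} (hp : p.Prime) (hp2 : p ≠ 2)
    (hA : Fintype.card A = p) :
    Fintype.card (Block ((c, (1 : A)) : H × A)) * (4 * n * p) =
      4 ^ (n * p) + (univ.filter fun g : H => g ∉ Subgroup.zpowers D.u ∧ g * g = 1).card * 2 ^ (n * p) +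
        (p - 1) * (4 ^ n + (univ.filter fun g : H => g ∉ Subgroup.zpowers D.u ∧ g * g = 1).card * 2 ^ n) := by
  have hcen : ∀ x : H, x * c = c * x := fun x => by have h := D.comm_pow_n x; rwa [D.hun] at h
  have hpH : ¬ p ∣ Fintype.card H := by
    rw [card_eq_four_mul_of_datum D, ha, show 4 * 2 ^ a = 2 ^ (a + 2) by ring]
    intro hd
    exact hp2 ((Nat.prime_dvd_prime_iff_eq hp Nat.prime_two).mp (hp.dvd_of_dvd_pow hd))
  have h := card_block_prod_mul_card_of_prime (A := A) c hc2 hcen hp hA hpH hp2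
  rw [sum_burnside_twisted D hc2 hc1 ha p, card_eq_four_mul_of_datum D, card_block_mul_four_mul D hc2 hc1 ha] at h
  exact h

/-- **… arithmetic form**: `β(H × A)·(4n·p) = 4^{np} + N·2^{np} + (p − 1)·(4ⁿ + N·2ⁿ)` with `N = #{z ∈ ℤ/2n ∣ (r+1)·z = 0}`. [folklore] -/
theorem card_block_prod_mul_eq (hc2 : c * c = 1) (hc1 : c ≠ 1) {a : ℕ} (ha : n = 2 ^ a) {p : ℕ} (hp : p.Prime) (hp2 : p ≠ 2)
    (hA : Fintype.card A = p) :
    Fintype.card (Block ((c, (1 : A)) : H × A)) * (4 * n * p) =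
      4 ^ (n * p) + (univ.filter fun z : ZMod (2 * n) => (((D.r + 1 : ℕ) : ZMod (2 * n)) * z = 0)).card * 2 ^ (n * p) +
        (p - 1) * (4 ^ n + (univ.filter fun z : ZMod (2 * n) => (((D.r + 1 : ℕ) : ZMod (2 * n)) * z = 0)).card * 2 ^ n) := by
  rw [card_block_prod_mul D hc2 hc1 ha hp hp2 hA, card_coset_involutions D]

/-! ## §3 Rows at level `4` (`|H| = 16`) over `C₃` -/

section Rows

variable {c : H} (D : IndexTwoCyclic.Datum H c 4)

/-- **Row `D₈ × C₃ = (24,7)`** (`r + 1 ≡ 0 (mod 8)`): **`β = 350224`**. [folklore] -/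
theorem card_block_dihedralEight_prod_three (hc2 : c * c = 1) (hc1 : c ≠ 1) (hr : ((D.r + 1 : ℕ) : ZMod (2 * 4)) = 0)
    (hA : Fintype.card A = 3) : Fintype.card (Block ((c, (1 : A)) : H × A)) = 350224 := by
  have h := card_block_prod_mul_eq D hc2 hc1 (a := 2) (by norm_num) Nat.prime_three (by norm_num) hA
  have hc : (univ.filter fun z : ZMod (2 * 4) => (0 : ZMod (2 * 4)) * z = 0).card = 8 := by decide
  rw [hr, hc] at h
  norm_num at h
  omega

/-- **Row `SD₁₆ × C₃`** (`r + 1 ≡ 4 (mod 8)`): **`β = 349880`**. [folklore] -/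
theorem card_block_semidihedralSixteen_prod_three (hc2 : c * c = 1) (hc1 : c ≠ 1) (hr : ((D.r + 1 : ℕ) : ZMod (2 * 4)) = 4)
    (hA : Fintype.card A = 3) : Fintype.card (Block ((c, (1 : A)) : H × A)) = 349880 := by
  have h := card_block_prod_mul_eq D hc2 hc1 (a := 2) (by norm_num) Nat.prime_three (by norm_num) hA
  have hc : (univ.filter fun z : ZMod (2 * 4) => (4 : ZMod (2 * 4)) * z = 0).card = 4 := by decide
  rw [hr, hc] at h
  norm_num at h
  omega

/-- **Row `M₁₆ × C₃`** (`r + 1 ≡ 6 (mod 8)`): **`β = 349708`**. [folklore] -/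
theorem card_block_modularSixteen_prod_three (hc2 : c * c = 1) (hc1 : c ≠ 1) (hr : ((D.r + 1 : ℕ) : ZMod (2 * 4)) = 6)
    (hA : Fintype.card A = 3) : Fintype.card (Block ((c, (1 : A)) : H × A)) = 349708 := by
  have h := card_block_prod_mul_eq D hc2 hc1 (a := 2) (by norm_num) Nat.prime_three (by norm_num) hA
  have hc : (univ.filter fun z : ZMod (2 * 4) => (6 : ZMod (2 * 4)) * z = 0).card = 2 := by decide
  rw [hr, hc] at h
  norm_num at h
  omega

/-- **Row `D₈ × C₃ = (24,7)`: `φ₂ = 350222`** — the exact floor of gen 56ʼs first open mixed twist (`μ ∈ {350222, 350223}` by gen 49 IX). [folklore] -/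
theorem fibreTwo_dihedralEight_prod_three (hc2 : c * c = 1) (hc1 : c ≠ 1) (hr : ((D.r + 1 : ℕ) : ZMod (2 * 4)) = 0)
    (hA : Fintype.card A = 3) : fibreTwo ((c, (1 : A)) : H × A) (prod_c_mul_c hc2) = 350222 := by
  have hcen : ∀ x : H, x * c = c * x := fun x => by have h := D.comm_pow_n x; rwa [D.hun] at h
  have hβG := card_block_dihedralEight_prod_three (A := A) D hc2 hc1 hr hA
  have h16 : Fintype.card H = 4 * 4 := card_eq_four_mul_of_datum D
  have hG := fibreTwo_prod_add_card_block (A := A) c hc2 hc1 hcen (by rw [h16]; norm_num) (by rw [hA]; exact ⟨1, rfl⟩)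
  -- `β(D₈) = 24`, `φ₂(D₈) = 22`
  have hβ := card_block_mul_four_mul_eq D hc2 hc1 (a := 2) (by norm_num)
  have hc : (univ.filter fun z : ZMod (2 * 4) => (0 : ZMod (2 * 4)) * z = 0).card = 8 := by decide
  rw [hr, hc] at hβ
  norm_num at hβ
  have hβH : Fintype.card (Block c) = 24 := by omega
  have hnot : c ∉ Subgroup.zpowers (D.u ^ (D.r + 1)) := by
    have h0 : D.u ^ (D.r + 1) = 1 := by
      rw [← pow_zero D.u, D.pow_eq_pow_iff, Nat.cast_zero]
      exact hr
    rw [h0, Subgroup.zpowers_one_eq_bot, Subgroup.mem_bot]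
    exact hc1
  have hφH := card_block_eq_fibreTwo_add_two_of_notMem D hc2 hc1 hnot
  omega

/-- **Row `SD₁₆ × C₃`: `φ₂ = 349879`** (`d₂(SD₁₆) = 1`). [folklore] -/
theorem fibreTwo_semidihedralSixteen_prod_three (hc2 : c * c = 1) (hc1 : c ≠ 1) (hr : ((D.r + 1 : ℕ) : ZMod (2 * 4)) = 4)
    (hA : Fintype.card A = 3) : fibreTwo ((c, (1 : A)) : H × A) (prod_c_mul_c hc2) = 349879 := by
  have hcen : ∀ x : H, x * c = c * x := fun x => by have h := D.comm_pow_n x; rwa [D.hun] at h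
  have hβG := card_block_semidihedralSixteen_prod_three (A := A) D hc2 hc1 hr hA
  have h16 : Fintype.card H = 4 * 4 := card_eq_four_mul_of_datum D
  have hG := fibreTwo_prod_add_card_block (A := A) c hc2 hc1 hcen (by rw [h16]; norm_num) (by rw [hA]; exact ⟨1, rfl⟩)
  have hβH : Fintype.card (Block c) = 20 := card_block_eq_twenty D hc2 hc1 hr
  have hmem : c ∈ Subgroup.zpowers (D.u ^ (D.r + 1)) := by
    have h4 : D.u ^ (D.r + 1) = D.u ^ 4 := by
      rw [D.pow_eq_pow_iff]
      exact_mod_cast hr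
    rw [h4, D.hun]
    exact Subgroup.mem_zpowers c
  have hφH := card_block_eq_fibreTwo_add_one_of_twist D hc2 hc1 ⟨2, rfl⟩ hmem
  omega

/-- **Row `M₁₆ × C₃`: `φ₂ = 349707`** (`d₂(M₁₆) = 1`). [folklore] -/
theorem fibreTwo_modularSixteen_prod_three (hc2 : c * c = 1) (hc1 : c ≠ 1) (hr : ((D.r + 1 : ℕ) : ZMod (2 * 4)) = 6)
    (hA : Fintype.card A = 3) : fibreTwo ((c, (1 : A)) : H × A) (prod_c_mul_c hc2) = 349707 := by
  have hcen : ∀ x : H, x * c = c * x := fun x => by have h := D.comm_pow_n x; rwa [D.hun] at h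
  have hβG := card_block_modularSixteen_prod_three (A := A) D hc2 hc1 hr hA
  have h16 : Fintype.card H = 4 * 4 := card_eq_four_mul_of_datum D
  have hG := fibreTwo_prod_add_card_block (A := A) c hc2 hc1 hcen (by rw [h16]; norm_num) (by rw [hA]; exact ⟨1, rfl⟩)
  have hβH : Fintype.card (Block c) = 18 := card_block_eq_eighteen D hc2 hc1 hr
  have hmem : c ∈ Subgroup.zpowers (D.u ^ (D.r + 1)) := by
    have h6 : D.u ^ (D.r + 1) = D.u ^ 6 := by
      rw [D.pow_eq_pow_iff]
      exact_mod_cast hr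
    rw [h6]
    refine Subgroup.mem_zpowers_iff.mpr ⟨(2 : ℕ), ?_⟩
    rw [zpow_natCast, ← pow_mul, show 6 * 2 = 2 * 4 + 4 by norm_num, pow_add, ← D.hord, pow_orderOf_eq_one, one_mul, D.hun]
  have hφH := card_block_eq_fibreTwo_add_one_of_twist D hc2 hc1 ⟨2, rfl⟩ hmem
  omega

end Rows

end

end Summit.HodgeConjecture.CorCM.Census.SylowTransfer
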